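import Mathlib.Analysis.Complex.Basic
import Literature.Probability.RandomPlanarGeometry.CurveTortuosity
import HarnessLib

/-!
# Slit necklace, chart r2.1: radial split of a traversed shell away from two marked points

Crux `SAWLeftRightFKG.FKGToTraversalBound` (stmt-CriticalPhenomena-1878), line `slit-necklace`,
registered helper stub `hasTraversals_radial_part` of `stub_necklaceAssembly` (chart r2.1,
"radial split").

Deterministic geometry.  Let `D(x; ρ, R)` be a shell with `R - ρ ≥ 6 η`, `η > 0`, and let `a`,
`b` be two marked points.  Removing from the radial interval `[ρ, R]` the two open windows of
half-width `η` about the radii `dist a x` and `dist b x` leaves at most three closed intervals of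
total length `≥ R - ρ - 4 η`; the longest of them, `[ρ₁, R₁]`, has `3 (R₁ - ρ₁) ≥ R - ρ - 4 η`.
Every point `z` of the closed band `ρ₁ ≤ dist z x ≤ R₁` has `|dist z x - dist a x| ≥ η`, hence
`dist z a ≥ η` (triangle inequality), and likewise for `b`; and `k` separate traversals of
`D(x; ρ, R)` are `k` separate traversals of the nested shell `D(x; ρ₁, R₁)`
(`Curve.HasTraversals.mono'`).

The real-variable core (`radialPart_real_of_le`) picks, with `m₁ ≤ m₂` the two sorted radii, the
first of the three clamped candidates `[ρ, min R (m₁ - η)]`, `[max ρ (m₂ + η), R]`,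
`[max ρ (m₁ + η), min R (m₂ - η)]` whose unclamped length is at least a third of `R - ρ - 4 η`;
all inequalities are linear arithmetic after `min_choice` / `max_choice`.

Only theorems; axioms are the standard three.
-/

noncomputable section

open Set Metric
open Literature.Probability.RandomPlanarGeometry

namespace Summit.CriticalPhenomena.SAWScalingLimit.Theorems.FKGToTraversalBound.SlitNecklace

/-- **Real-variable core, sorted radii.**  For `m₁ ≤ m₂`, `η > 0` and `R - ρ ≥ 6 η` there is a
closed sub-interval `[ρ₁, R₁] ⊆ [ρ, R]` with `3 (R₁ - ρ₁) + 4 η ≥ R - ρ` all of whose points are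
at distance `≥ η` from `m₁` and from `m₂` (stated without absolute values). [folklore] -/
private theorem radialPart_real_of_le (ρ R η m₁ m₂ : ℝ) (hη : 0 < η) (hR : 6 * η ≤ R - ρ)
    (h12 : m₁ ≤ m₂) :
    ∃ ρ₁ R₁ : ℝ, ρ ≤ ρ₁ ∧ R₁ ≤ R ∧ R - ρ ≤ 3 * (R₁ - ρ₁) + 4 * η ∧
      ∀ d : ℝ, ρ₁ ≤ d → d ≤ R₁ →
        (d + η ≤ m₁ ∨ m₁ + η ≤ d) ∧ (d + η ≤ m₂ ∨ m₂ + η ≤ d) := by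
  by_cases h1 : R - ρ - 4 * η ≤ 3 * (m₁ - η - ρ)
  · -- the inner candidate `[ρ, min R (m₁ - η)]`
    refine ⟨ρ, min R (m₁ - η), le_rfl, min_le_left _ _, ?_, fun d _ hd ↦ ?_⟩
    · rcases min_choice R (m₁ - η) with h | h <;> rw [h] <;> linarith
    · have hd' : d ≤ m₁ - η := hd.trans (min_le_right _ _)
      exact ⟨Or.inl (by linarith), Or.inl (by linarith)⟩
  by_cases h3 : R - ρ - 4 * η ≤ 3 * (R - m₂ - η)
  · -- the outer candidate `[max ρ (m₂ + η), R]`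
    refine ⟨max ρ (m₂ + η), R, le_max_left _ _, le_rfl, ?_, fun d hd _ ↦ ?_⟩
    · rcases max_choice ρ (m₂ + η) with h | h <;> rw [h] <;> linarith
    · have hd' : m₂ + η ≤ d := (le_max_right _ _).trans hd
      exact ⟨Or.inr (by linarith), Or.inr (by linarith)⟩
  · -- the middle candidate `[max ρ (m₁ + η), min R (m₂ - η)]`
    refine ⟨max ρ (m₁ + η), min R (m₂ - η), le_max_left _ _, min_le_left _ _, ?_,
      fun d hd hd2 ↦ ?_⟩
    · push Not at h1 h3
      rcases max_choice ρ (m₁ + η) with h | h <;> rcases min_choice R (m₂ - η) with h' | h' <;>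
        rw [h, h'] <;> linarith
    · have hd' : m₁ + η ≤ d := (le_max_right _ _).trans hd
      have hd2' : d ≤ m₂ - η := hd2.trans (min_le_right _ _)
      exact ⟨Or.inr hd', Or.inl (by linarith)⟩

/-- **Real-variable core.**  For `η > 0` and `R - ρ ≥ 6 η` and any two reals `m₁`, `m₂` there is
a closed sub-interval `[ρ₁, R₁] ⊆ [ρ, R]` with `3 (R₁ - ρ₁) + 4 η ≥ R - ρ` all of whose points
are at distance `≥ η` from `m₁` and from `m₂`. [folklore] -/
private theorem radialPart_real (ρ R η m₁ m₂ : ℝ) (hη : 0 < η) (hR : 6 * η ≤ R - ρ) :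
    ∃ ρ₁ R₁ : ℝ, ρ ≤ ρ₁ ∧ R₁ ≤ R ∧ R - ρ ≤ 3 * (R₁ - ρ₁) + 4 * η ∧
      ∀ d : ℝ, ρ₁ ≤ d → d ≤ R₁ →
        (d + η ≤ m₁ ∨ m₁ + η ≤ d) ∧ (d + η ≤ m₂ ∨ m₂ + η ≤ d) := by
  rcases le_total m₁ m₂ with h | h
  · exact radialPart_real_of_le ρ R η m₁ m₂ hη hR h
  · obtain ⟨ρ₁, R₁, hρ, hR', hlen, hd⟩ := radialPart_real_of_le ρ R η m₂ m₁ hη hR h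
    exact ⟨ρ₁, R₁, hρ, hR', hlen, fun d h₁ h₂ ↦ (hd d h₁ h₂).symm⟩

/-- **Radial split.**  If the shell `D(x; ρ, R)` with `R - ρ ≥ 6 η > 0` is traversed by `k`
separate segments of the curve `γ`, then so is a nested shell `D(x; ρ₁, R₁)`,
`ρ ≤ ρ₁`, `R₁ ≤ R`, of width `R₁ - ρ₁ ≥ (R - ρ - 4 η) / 3`, whose closed band
`ρ₁ ≤ dist z x ≤ R₁` stays at distance `≥ η` from the two marked points `a` and `b`: remove the
two radial windows of half-width `η` about `dist a x`, `dist b x` from `[ρ, R]` and keep the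
longest remaining interval. [folklore] -/
theorem hasTraversals_radial_part : ∀ (γ : Curve ℂ) (x a b : ℂ) (ρ R η : ℝ) (k : ℕ), 0 < η → 6 * η ≤ R - ρ → γ.HasTraversals k x ρ R → ∃ ρ₁ R₁ : ℝ, ρ ≤ ρ₁ ∧ R₁ ≤ R ∧ R - ρ ≤ 3 * (R₁ - ρ₁) + 4 * η ∧ (∀ z : ℂ, ρ₁ ≤ dist z x → dist z x ≤ R₁ → η ≤ dist z a ∧ η ≤ dist z b) ∧ γ.HasTraversals k x ρ₁ R₁ := by
  intro γ x a b ρ R η k hη hR hγ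
  obtain ⟨ρ₁, R₁, hρ₁, hR₁, hlen, havoid⟩ := radialPart_real ρ R η (dist a x) (dist b x) hη hR
  refine ⟨ρ₁, R₁, hρ₁, hR₁, hlen, fun z hz₁ hz₂ ↦ ?_, hγ.mono' hρ₁ hR₁⟩
  obtain ⟨ha, hb⟩ := havoid (dist z x) hz₁ hz₂
  -- `|dist z x - dist p x| ≤ dist z p` for `p = a, b`
  have ta₁ := dist_triangle a z x
  have ta₂ := dist_triangle z a x
  have tb₁ := dist_triangle b z x
  have tb₂ := dist_triangle z b x
  rw [dist_comm a z] at ta₁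
  rw [dist_comm b z] at tb₁
  refine ⟨?_, ?_⟩
  · rcases ha with h | h <;> linarith
  · rcases hb with h | h <;> linarith

end Summit.CriticalPhenomena.SAWScalingLimit.Theorems.FKGToTraversalBound.SlitNecklace

end
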